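import Summits.QuantumFields.QCD.Theorems.SpectralDefectExtinctionTipPricingSchurLatticeLocality
import Summits.QuantumFields.QCD.Theorems.SpectralDefectExtinctionTipPricingIndexEquiv
import Summits.QuantumFields.QCD.Theorems.SpectralDefectExtinctionTipPricingBoxBlockIndexAux

/-!
# Index of a tiled box: lattice bookkeeping (auxiliary to sub-goal ASM1 of crux stmt-QuantumFields-8967)

Lattice-side inputs of `boxBlock_index_of_cells` (file `…TipPricingBoxBlockIndex.lean`; sub-goal ASM1 of the modular
cell–wall template, crux `Summit.QuantumFields.QCD.Theses.SpectralDefectExtinction.TipPricing`, line `hermitian-flow-coarea`,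
lead c2), for `H = Γ₅ (D_W(U) − δ)` on the torus `ℤ_n⁴`, a big box `c + {−R..R}⁴` (`2R+1 < n`) and disjoint cells-with-collars
`z k + {−(ℓ+W)..ℓ+W}⁴` inside it:
* the wall block and the collar blocks of `H` (sites of the big box, resp. of a cell-with-collar, off the cell cores) have the
  norm gap `(3/8 − δ − 12η)²`, inertia exactly half and are invertible, when the links based off the cell cores are `η`-close
  to the centre-flux pattern (`wallFacts`, `collarFacts`; from `wallBlock_gap_and_half`, transported to the constructive
  `Fintype` instances of the index subtypes by `gapHalfDet_instIndep`);
* a cell-core point is never coupled by `H` to a point of another cell-with-collar (`cellCore_entry_eq_zero`; range one of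
  `D_W` and the outer-face geometry `schurLoc_outerFace`);
* the cell indices `(↥(box 4 ℓ) × Fin 3 × Fin 4) × Fin N` parametrise the cell index subtype bijectively (`cellIdx_equiv`);
* site counts: `(2R+1)⁴ = N (2ℓ+1)⁴ + #wall sites` and `(2(ℓ+W)+1)⁴ = (2ℓ+1)⁴ + #collar sites` (`card_wallSites`,
  `card_collarSites`, from the index equivalences `boxIdx_equiv_cells_sum_wall`, `cwcIdx_equiv_cell_sum_collar`).
Supports stmt-QuantumFields-8967 (helper; closes no item).
-/

noncomputable section

namespace Summit.QuantumFields.QCD.Cruxes.TipPricing.ModularTemplate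

open Matrix
open Literature.MathematicalPhysics.QuantumLattice Literature.MathematicalPhysics.QuantumFieldTheory
  Literature.Probability.LatticeModels
open Summit.QuantumFields.QCD.Theorems.ExtinctionBuildsQCD.Negative
open scoped BigOperators

variable {n : ℕ} [NeZero n]

/-! ### Wall and collar blocks: gap, inertia half, invertibility -/

/-- `wallBlock_gap_and_half` for a site predicate `P`, stated with arbitrary `Fintype`/`DecidableEq` instances on the index
subtypes. -/
theorem wallBlock_gap_and_half_pred (U : GaugeConfig 4 n SU3) (c : Fin 4 → ℤ) (R : ℕ) (hR : 2 * R + 1 < n)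
    (P : TorusSite 4 n → Prop) (η δ : ℝ) (hη : 0 ≤ η) (hδ : δ + 12 * η < 3 / 8)
    [iF : Fintype {p : TorusSite 4 n × Fin 3 × Fin 4 // P p.1}] [iD : DecidableEq {p : TorusSite 4 n × Fin 3 × Fin 4 // P p.1}]
    [iS : Fintype {x : TorusSite 4 n // P x}]
    (hS : ∀ x, P x → ∃ y : Fin 4 → ℤ, y ∈ box 4 R ∧ Torus.proj n (c + y) = x)
    (hflux : ∀ y : Fin 4 → ℤ, y ∈ box 4 R → P (Torus.proj n (c + y)) → ∀ μ : Fin 4,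
      P (Torus.proj n (c + y + Pi.single μ 1)) → ∀ i j : Fin 3,
        ‖(↑(U (Torus.proj n (c + y), μ)) : Matrix (Fin 3) (Fin 3) ℂ) i j -
          (if i = j then (if μ = 1 then Complex.exp (2 * Real.pi * Complex.I * ((y 0 : ℤ) : ℂ) / 3)
            else if μ = 3 then Complex.exp (2 * Real.pi * Complex.I * ((y 2 : ℤ) : ℂ) / 3) else 1) else 0)‖ ≤ η) :
    (∀ v : {p : TorusSite 4 n × Fin 3 × Fin 4 // P p.1} → ℂ,
      (3 / 8 - δ - 12 * η) ^ 2 * ∑ i, ‖v i‖ ^ 2 ≤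
        ∑ i, ‖(((spinorLift gammaFive * wilsonDirac (fundamentalRep (Fin 3)) U (-δ) 1).submatrix
          (Subtype.val : {p : TorusSite 4 n × Fin 3 × Fin 4 // P p.1} → _) Subtype.val) *ᵥ v) i‖ ^ 2) ∧
    negRootCount ((spinorLift gammaFive * wilsonDirac (fundamentalRep (Fin 3)) U (-δ) 1).submatrix
        (Subtype.val : {p : TorusSite 4 n × Fin 3 × Fin 4 // P p.1} → _) Subtype.val) =
      6 * Fintype.card {x : TorusSite 4 n // P x} ∧
    ((spinorLift gammaFive * wilsonDirac (fundamentalRep (Fin 3)) U (-δ) 1).submatrix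
        (Subtype.val : {p : TorusSite 4 n × Fin 3 × Fin 4 // P p.1} → _) Subtype.val).det ≠ 0 := by
  have h := wallBlock_gap_and_half U c R hR {x | P x} η δ hη hδ hS hflux
  have h2 := gapHalfDet_instIndep (i₂ := iF) (d₂ := iD) (j₂ := iS) _ _ h
  exact h2

/-- **Wall block.**  If every link based at a big-box site off the cell cores `z k + {−ℓ..ℓ}⁴` is `η`-close to the centre-flux
pattern, the block of `H = Γ₅(D_W(U) − δ)` over the wall (big box minus cell cores) has the norm gap `(3/8 − δ − 12η)²`,
exactly `6 · #wall sites` negative characteristic roots, and is invertible. -/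
theorem wallFacts (U : GaugeConfig 4 n SU3) (c : Fin 4 → ℤ) (ℓ R N : ℕ) (hR : 2 * R + 1 < n) (z : Fin N → (Fin 4 → ℤ))
    (η δ : ℝ) (hη : 0 ≤ η) (hδ : δ + 12 * η < 3 / 8)
    (hflux : ∀ (x : Fin 4 → ℤ), x ∈ box 4 R → (¬ ∃ (k : Fin N) (y : Fin 4 → ℤ), y ∈ box 4 ℓ ∧ x = z k + y) →
      ∀ (μ : Fin 4) (i j : Fin 3),
        ‖(↑(U (Torus.proj n (c + x), μ)) : Matrix (Fin 3) (Fin 3) ℂ) i j -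
            (if i = j then
              (if μ = 1 then Complex.exp (2 * Real.pi * Complex.I * ((x 0 : ℤ) : ℂ) / 3)
               else if μ = 3 then Complex.exp (2 * Real.pi * Complex.I * ((x 2 : ℤ) : ℂ) / 3) else 1)
             else 0)‖ ≤ η) :
    (∀ v : {p : TorusSite 4 n × Fin 3 × Fin 4 //
        (∃ (y : ↥(box 4 R)), Torus.proj n (c + (y : Fin 4 → ℤ)) = p.1) ∧
        ¬ ∃ (k : Fin N) (y : ↥(box 4 ℓ)), Torus.proj n (c + z k + (y : Fin 4 → ℤ)) = p.1} → ℂ,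
      (3 / 8 - δ - 12 * η) ^ 2 * ∑ i, ‖v i‖ ^ 2 ≤
        ∑ i, ‖(((spinorLift gammaFive * wilsonDirac (fundamentalRep (Fin 3)) U (-δ) 1).submatrix
          (Subtype.val : {p : TorusSite 4 n × Fin 3 × Fin 4 //
            (∃ (y : ↥(box 4 R)), Torus.proj n (c + (y : Fin 4 → ℤ)) = p.1) ∧
            ¬ ∃ (k : Fin N) (y : ↥(box 4 ℓ)), Torus.proj n (c + z k + (y : Fin 4 → ℤ)) = p.1} → _) Subtype.val) *ᵥ v) i‖ ^ 2) ∧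
    negRootCount ((spinorLift gammaFive * wilsonDirac (fundamentalRep (Fin 3)) U (-δ) 1).submatrix
        (Subtype.val : {p : TorusSite 4 n × Fin 3 × Fin 4 //
          (∃ (y : ↥(box 4 R)), Torus.proj n (c + (y : Fin 4 → ℤ)) = p.1) ∧
          ¬ ∃ (k : Fin N) (y : ↥(box 4 ℓ)), Torus.proj n (c + z k + (y : Fin 4 → ℤ)) = p.1} → _) Subtype.val) =
      6 * Fintype.card {x : TorusSite 4 n //
        (∃ (y : ↥(box 4 R)), Torus.proj n (c + (y : Fin 4 → ℤ)) = x) ∧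
        ¬ ∃ (k : Fin N) (y : ↥(box 4 ℓ)), Torus.proj n (c + z k + (y : Fin 4 → ℤ)) = x} ∧
    ((spinorLift gammaFive * wilsonDirac (fundamentalRep (Fin 3)) U (-δ) 1).submatrix
        (Subtype.val : {p : TorusSite 4 n × Fin 3 × Fin 4 //
          (∃ (y : ↥(box 4 R)), Torus.proj n (c + (y : Fin 4 → ℤ)) = p.1) ∧
          ¬ ∃ (k : Fin N) (y : ↥(box 4 ℓ)), Torus.proj n (c + z k + (y : Fin 4 → ℤ)) = p.1} → _) Subtype.val).det ≠ 0 := by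
  refine wallBlock_gap_and_half_pred U c R hR (fun x => (∃ (y : ↥(box 4 R)), Torus.proj n (c + (y : Fin 4 → ℤ)) = x) ∧
      ¬ ∃ (k : Fin N) (y : ↥(box 4 ℓ)), Torus.proj n (c + z k + (y : Fin 4 → ℤ)) = x) η δ hη hδ ?_ ?_
  · rintro x ⟨⟨⟨y, hy⟩, hx⟩, -⟩
    exact ⟨y, hy, hx⟩
  · rintro y hy ⟨-, hP⟩ μ - i j
    refine hflux y hy ?_ μ i j
    rintro ⟨k, y', hy', rfl⟩
    exact hP ⟨k, ⟨y', hy'⟩, congrArg (Torus.proj n) (add_assoc c (z k) y')⟩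

/-- **Collar block.**  Under the same flux hypothesis, for cells-with-collars inside the big box with pairwise disjoint
extensions, the block of `H` over the collar of cell `k` (cell-with-collar minus cell core) has the norm gap
`(3/8 − δ − 12η)²`, exactly `6 · #collar sites` negative characteristic roots, and is invertible. -/
theorem collarFacts (U : GaugeConfig 4 n SU3) (c : Fin 4 → ℤ) (ℓ W R N : ℕ) (hR : 2 * R + 1 < n)
    (z : Fin N → (Fin 4 → ℤ)) (hin : ∀ k, ∀ (y : Fin 4 → ℤ), y ∈ box 4 (ℓ + W) → z k + y ∈ box 4 R)
    (hdisj : ∀ k k', k ≠ k' → ∀ (y y' : Fin 4 → ℤ), y ∈ box 4 (ℓ + W) → y' ∈ box 4 (ℓ + W) → z k + y ≠ z k' + y')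
    (η δ : ℝ) (hη : 0 ≤ η) (hδ : δ + 12 * η < 3 / 8)
    (hflux : ∀ (x : Fin 4 → ℤ), x ∈ box 4 R → (¬ ∃ (k : Fin N) (y : Fin 4 → ℤ), y ∈ box 4 ℓ ∧ x = z k + y) →
      ∀ (μ : Fin 4) (i j : Fin 3),
        ‖(↑(U (Torus.proj n (c + x), μ)) : Matrix (Fin 3) (Fin 3) ℂ) i j -
            (if i = j then
              (if μ = 1 then Complex.exp (2 * Real.pi * Complex.I * ((x 0 : ℤ) : ℂ) / 3)
               else if μ = 3 then Complex.exp (2 * Real.pi * Complex.I * ((x 2 : ℤ) : ℂ) / 3) else 1)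
             else 0)‖ ≤ η) (k : Fin N) :
    (∀ v : {p : TorusSite 4 n × Fin 3 × Fin 4 //
        (∃ (y : ↥(box 4 (ℓ + W))), Torus.proj n (c + z k + (y : Fin 4 → ℤ)) = p.1) ∧
        ¬ ∃ (y : ↥(box 4 ℓ)), Torus.proj n (c + z k + (y : Fin 4 → ℤ)) = p.1} → ℂ,
      (3 / 8 - δ - 12 * η) ^ 2 * ∑ i, ‖v i‖ ^ 2 ≤
        ∑ i, ‖(((spinorLift gammaFive * wilsonDirac (fundamentalRep (Fin 3)) U (-δ) 1).submatrix
          (Subtype.val : {p : TorusSite 4 n × Fin 3 × Fin 4 //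
            (∃ (y : ↥(box 4 (ℓ + W))), Torus.proj n (c + z k + (y : Fin 4 → ℤ)) = p.1) ∧
            ¬ ∃ (y : ↥(box 4 ℓ)), Torus.proj n (c + z k + (y : Fin 4 → ℤ)) = p.1} → _) Subtype.val) *ᵥ v) i‖ ^ 2) ∧
    negRootCount ((spinorLift gammaFive * wilsonDirac (fundamentalRep (Fin 3)) U (-δ) 1).submatrix
        (Subtype.val : {p : TorusSite 4 n × Fin 3 × Fin 4 //
          (∃ (y : ↥(box 4 (ℓ + W))), Torus.proj n (c + z k + (y : Fin 4 → ℤ)) = p.1) ∧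
          ¬ ∃ (y : ↥(box 4 ℓ)), Torus.proj n (c + z k + (y : Fin 4 → ℤ)) = p.1} → _) Subtype.val) =
      6 * Fintype.card {x : TorusSite 4 n //
        (∃ (y : ↥(box 4 (ℓ + W))), Torus.proj n (c + z k + (y : Fin 4 → ℤ)) = x) ∧
        ¬ ∃ (y : ↥(box 4 ℓ)), Torus.proj n (c + z k + (y : Fin 4 → ℤ)) = x} ∧
    ((spinorLift gammaFive * wilsonDirac (fundamentalRep (Fin 3)) U (-δ) 1).submatrix
        (Subtype.val : {p : TorusSite 4 n × Fin 3 × Fin 4 //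
          (∃ (y : ↥(box 4 (ℓ + W))), Torus.proj n (c + z k + (y : Fin 4 → ℤ)) = p.1) ∧
          ¬ ∃ (y : ↥(box 4 ℓ)), Torus.proj n (c + z k + (y : Fin 4 → ℤ)) = p.1} → _) Subtype.val).det ≠ 0 := by
  refine wallBlock_gap_and_half_pred U c R hR
    (fun x => (∃ (y : ↥(box 4 (ℓ + W))), Torus.proj n (c + z k + (y : Fin 4 → ℤ)) = x) ∧
      ¬ ∃ (y : ↥(box 4 ℓ)), Torus.proj n (c + z k + (y : Fin 4 → ℤ)) = x) η δ hη hδ ?_ ?_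
  · rintro x ⟨⟨⟨y, hy⟩, hx⟩, -⟩
    exact ⟨z k + y, hin k y hy, by rw [← add_assoc]; exact hx⟩
  · rintro y hy ⟨⟨⟨y₂, hy₂⟩, h₂⟩, hP⟩ μ - i j
    refine hflux y hy ?_ μ i j
    rintro ⟨k', y', hy', rfl⟩
    by_cases hk : k = k'
    · subst hk
      exact hP ⟨⟨y', hy'⟩, congrArg (Torus.proj n) (add_assoc c (z k) y')⟩
    · have heq : z k + y₂ = z k' + y' :=
        wallDecay_boxCoord_unique hR c (hin k y₂ hy₂) hy (by rw [← add_assoc]; exact h₂)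
      exact hdisj k k' hk y₂ y' hy₂ (box_mono 4 (Nat.le_add_right ℓ W) hy') heq

/-! ### Geometry: cell cores are decoupled from foreign cells-with-collars -/

/-- A point of the cell core `z k + {−ℓ..ℓ}⁴` and a point of another cell-with-collar `z k' + {−(ℓ+W)..ℓ+W}⁴` (`k ≠ k'`,
`W ≥ 1`) are neither equal nor nearest neighbours, so the corresponding entries of `H = Γ₅(D_W(U) − δ)` vanish. -/
theorem cellCore_entry_eq_zero (U : GaugeConfig 4 n SU3) (δ : ℝ) (c : Fin 4 → ℤ) {ℓ W R N : ℕ} (hW : 1 ≤ W)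
    (hR : 2 * R + 1 < n) (z : Fin N → (Fin 4 → ℤ))
    (hin : ∀ k, ∀ (y : Fin 4 → ℤ), y ∈ box 4 (ℓ + W) → z k + y ∈ box 4 R)
    (hdisj : ∀ k k', k ≠ k' → ∀ (y y' : Fin 4 → ℤ), y ∈ box 4 (ℓ + W) → y' ∈ box 4 (ℓ + W) → z k + y ≠ z k' + y')
    {k k' : Fin N} (hk : k ≠ k') {y y' : Fin 4 → ℤ} (hy : y ∈ box 4 ℓ) (hy' : y' ∈ box 4 (ℓ + W))
    {p q : TorusSite 4 n × Fin 3 × Fin 4} (hp : p.1 = Torus.proj n (c + z k + y))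
    (hq : q.1 = Torus.proj n (c + z k' + y')) :
    (spinorLift gammaFive * wilsonDirac (fundamentalRep (Fin 3)) U (-δ) 1 :
      Matrix (TorusSite 4 n × Fin 3 × Fin 4) (TorusSite 4 n × Fin 3 × Fin 4) ℂ) p q = 0 := by
  by_contra h
  have hop := schurLoc_H_hop U δ p q h
  rw [hp, hq, add_assoc, add_assoc] at hop
  have hyW : y ∈ box 4 (ℓ + W) := box_mono 4 (Nat.le_add_right ℓ W) hy
  have hadj := schurLoc_latticeAdj hR c (hin k y hyW) (hin k' y' hy') hop
  obtain ⟨i, hi⟩ := schurLoc_outerFace z hdisj (Ne.symm hk) hyW hy' (by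
    rcases hadj with h1 | ⟨μ, h2 | h3⟩
    · exact Or.inl h1.symm
    · exact Or.inr ⟨μ, Or.inr h2⟩
    · exact Or.inr ⟨μ, Or.inl h3⟩)
  have h1 := (mem_box.1 hy) i
  have h2 : |y i| ≤ ℓ := abs_le.2 ⟨h1.1, h1.2⟩
  have h3 : (ℓ : ℤ) + W ≤ ℓ := by exact_mod_cast hi.trans h2
  omega

/-! ### The cell index equivalence -/

omit [NeZero n] in
/-- The cell indices `(↥(box 4 ℓ) × Fin 3 × Fin 4) × Fin N` parametrise the quark indices over the union of the cell cores
bijectively (unique box coordinates, disjoint cells). -/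
theorem cellIdx_equiv (c : Fin 4 → ℤ) (ℓ W R N : ℕ) (hR : 2 * R + 1 < n) (z : Fin N → (Fin 4 → ℤ))
    (hin : ∀ k, ∀ (y : Fin 4 → ℤ), y ∈ box 4 (ℓ + W) → z k + y ∈ box 4 R)
    (hdisj : ∀ k k', k ≠ k' → ∀ (y y' : Fin 4 → ℤ), y ∈ box 4 (ℓ + W) → y' ∈ box 4 (ℓ + W) → z k + y ≠ z k' + y') :
    ∃ σ : (↥(box 4 ℓ) × Fin 3 × Fin 4) × Fin N ≃
        {p : TorusSite 4 n × Fin 3 × Fin 4 // ∃ (k : Fin N) (y : ↥(box 4 ℓ)), Torus.proj n (c + z k + (y : Fin 4 → ℤ)) = p.1},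
      ∀ q, ((σ q : {p : TorusSite 4 n × Fin 3 × Fin 4 //
          ∃ (k : Fin N) (y : ↥(box 4 ℓ)), Torus.proj n (c + z k + (y : Fin 4 → ℤ)) = p.1}) : TorusSite 4 n × Fin 3 × Fin 4) =
        (Torus.proj n (c + z q.2 + (q.1.1 : Fin 4 → ℤ)), q.1.2.1, q.1.2.2) := by
  have hmono : box 4 ℓ ⊆ box 4 (ℓ + W) := box_mono 4 (Nat.le_add_right ℓ W)
  let f : (↥(box 4 ℓ) × Fin 3 × Fin 4) × Fin N →
      {p : TorusSite 4 n × Fin 3 × Fin 4 // ∃ (k : Fin N) (y : ↥(box 4 ℓ)), Torus.proj n (c + z k + (y : Fin 4 → ℤ)) = p.1} :=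
    fun q => ⟨(Torus.proj n (c + z q.2 + (q.1.1 : Fin 4 → ℤ)), q.1.2.1, q.1.2.2), q.2, q.1.1, rfl⟩
  have hf : Function.Bijective f := by
    refine ⟨?_, ?_⟩
    · rintro ⟨⟨y, a, s⟩, k⟩ ⟨⟨y', a', s'⟩, k'⟩ h
      have h' := congrArg Subtype.val h
      simp only [f, Prod.mk.injEq] at h'
      obtain ⟨hproj, rfl, rfl⟩ := h'
      have hzy : z k + (y : Fin 4 → ℤ) = z k' + (y' : Fin 4 → ℤ) :=
        wallDecay_boxCoord_unique hR c (hin k _ (hmono y.2)) (hin k' _ (hmono y'.2))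
          (by simpa only [add_assoc] using hproj)
      have hk : k = k' := by
        by_contra hk
        exact hdisj k k' hk _ _ (hmono y.2) (hmono y'.2) hzy
      subst hk
      have hy : y = y' := Subtype.ext (add_left_cancel hzy)
      subst hy
      rfl
    · rintro ⟨⟨x, a, s⟩, k, y, h⟩
      exact ⟨((y, a, s), k), Subtype.ext (Prod.ext h rfl)⟩
  exact ⟨Equiv.ofBijective f hf, fun q => rfl⟩

/-! ### Site counts -/

omit [NeZero n] in
/-- Twelve quark indices (colour × spin) sit over every site. -/
theorem card_quarkIdx (P : TorusSite 4 n → Prop) [Fintype {p : TorusSite 4 n × Fin 3 × Fin 4 // P p.1}]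
    [Fintype {x : TorusSite 4 n // P x}] :
    Fintype.card {p : TorusSite 4 n × Fin 3 × Fin 4 // P p.1} = 12 * Fintype.card {x : TorusSite 4 n // P x} := by
  rw [Fintype.card_congr (Equiv.prodSubtypeFstEquivSubtypeProd (p := P) (β := Fin 3 × Fin 4)), Fintype.card_prod,
    Fintype.card_prod, Fintype.card_fin, Fintype.card_fin]
  ring

omit [NeZero n] in
/-- An embedded box of radius `R` (`2R+1 < n`) has exactly `(2R+1)⁴` sites. -/
theorem card_boxSites (c : Fin 4 → ℤ) (R : ℕ) (hR : 2 * R + 1 < n)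
    [Fintype {x : TorusSite 4 n // ∃ y : ↥(box 4 R), Torus.proj n (c + (y : Fin 4 → ℤ)) = x}] :
    Fintype.card {x : TorusSite 4 n // ∃ y : ↥(box 4 R), Torus.proj n (c + (y : Fin 4 → ℤ)) = x} = (2 * R + 1) ^ 4 := by
  rw [← card_box 4 R, ← Fintype.card_coe]
  refine (Fintype.card_congr (Equiv.ofBijective
    (fun y : ↥(box 4 R) => (⟨Torus.proj n (c + (y : Fin 4 → ℤ)), y, rfl⟩ :
      {x : TorusSite 4 n // ∃ y : ↥(box 4 R), Torus.proj n (c + (y : Fin 4 → ℤ)) = x})) ⟨?_, ?_⟩)).symm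
  · intro y y' h
    exact Subtype.ext (wallDecay_boxCoord_unique hR c y.2 y'.2 (congrArg Subtype.val h))
  · rintro ⟨x, y, hy⟩
    exact ⟨y, Subtype.ext hy⟩

/-- **Wall site count.**  For `N` disjoint cell cores `z k + {−ℓ..ℓ}⁴` inside the big box:
`(2R+1)⁴ = (2ℓ+1)⁴ · N + #wall sites`. -/
theorem card_wallSites (c : Fin 4 → ℤ) (ℓ W R N : ℕ) (hR : 2 * R + 1 < n) (z : Fin N → (Fin 4 → ℤ))
    (hin : ∀ k, ∀ (y : Fin 4 → ℤ), y ∈ box 4 (ℓ + W) → z k + y ∈ box 4 R)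
    (hdisj : ∀ k k', k ≠ k' → ∀ (y y' : Fin 4 → ℤ), y ∈ box 4 (ℓ + W) → y' ∈ box 4 (ℓ + W) → z k + y ≠ z k' + y') :
    (2 * R + 1) ^ 4 = (2 * ℓ + 1) ^ 4 * N + Fintype.card {x : TorusSite 4 n //
        (∃ (y : ↥(box 4 R)), Torus.proj n (c + (y : Fin 4 → ℤ)) = x) ∧
        ¬ ∃ (k : Fin N) (y : ↥(box 4 ℓ)), Torus.proj n (c + z k + (y : Fin 4 → ℤ)) = x} := by
  have hmono : box 4 ℓ ⊆ box 4 (ℓ + W) := box_mono 4 (Nat.le_add_right ℓ W)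
  obtain ⟨e, -, -⟩ := boxIdx_equiv_cells_sum_wall (n := n) c ℓ R N hR z (fun k y hy => hin k y (hmono hy))
    fun k k' hk y y' hy hy' => hdisj k k' hk y y' (hmono hy) (hmono hy')
  have h := Fintype.card_congr e
  rw [Fintype.card_sum, Fintype.card_prod, Fintype.card_prod, Fintype.card_prod, Fintype.card_fin, Fintype.card_fin,
    Fintype.card_fin, Fintype.card_coe, card_box,
    card_quarkIdx (fun x => ∃ (y : ↥(box 4 R)), Torus.proj n (c + (y : Fin 4 → ℤ)) = x),
    card_quarkIdx (fun x => (∃ (y : ↥(box 4 R)), Torus.proj n (c + (y : Fin 4 → ℤ)) = x) ∧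
      ¬ ∃ (k : Fin N) (y : ↥(box 4 ℓ)), Torus.proj n (c + z k + (y : Fin 4 → ℤ)) = x),
    card_boxSites c R hR] at h
  linarith

/-- **Collar site count.**  `(2(ℓ+W)+1)⁴ = (2ℓ+1)⁴ + #collar sites` for a cell-with-collar inside the big box. -/
theorem card_collarSites (c : Fin 4 → ℤ) (ℓ W R N : ℕ) (hR : 2 * R + 1 < n) (z : Fin N → (Fin 4 → ℤ))
    (hin : ∀ k, ∀ (y : Fin 4 → ℤ), y ∈ box 4 (ℓ + W) → z k + y ∈ box 4 R) (k : Fin N) :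
    (2 * (ℓ + W) + 1) ^ 4 = (2 * ℓ + 1) ^ 4 + Fintype.card {x : TorusSite 4 n //
        (∃ (y : ↥(box 4 (ℓ + W))), Torus.proj n (c + z k + (y : Fin 4 → ℤ)) = x) ∧
        ¬ ∃ (y : ↥(box 4 ℓ)), Torus.proj n (c + z k + (y : Fin 4 → ℤ)) = x} := by
  have hn : 2 * (ℓ + W) + 1 < n := by
    have h1 := (mem_box.1 (hin k (fun _ => ((ℓ + W : ℕ) : ℤ)) (mem_box.2 fun i => ⟨by omega, le_rfl⟩))) 0
    have h2 := (mem_box.1 (hin k (fun _ => -((ℓ + W : ℕ) : ℤ)) (mem_box.2 fun i => ⟨le_rfl, by omega⟩))) 0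
    simp only [Pi.add_apply] at h1 h2
    omega
  obtain ⟨e, -, -⟩ := cwcIdx_equiv_cell_sum_collar (n := n) c (z k) ℓ W hn
  have h := Fintype.card_congr e
  rw [Fintype.card_sum, Fintype.card_prod, Fintype.card_prod, Fintype.card_fin, Fintype.card_fin, Fintype.card_coe,
    card_box, card_quarkIdx (fun x => ∃ (y : ↥(box 4 (ℓ + W))), Torus.proj n (c + z k + (y : Fin 4 → ℤ)) = x),
    card_quarkIdx (fun x => (∃ (y : ↥(box 4 (ℓ + W))), Torus.proj n (c + z k + (y : Fin 4 → ℤ)) = x) ∧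
      ¬ ∃ (y : ↥(box 4 ℓ)), Torus.proj n (c + z k + (y : Fin 4 → ℤ)) = x),
    card_boxSites (c + z k) (ℓ + W) hn] at h
  omega

omit [NeZero n] in
/-- The side bound of a cell-with-collar inside the big box: `2(ℓ+W)+1 < n`. -/
theorem cwc_side_lt (ℓ W R N : ℕ) (hR : 2 * R + 1 < n) (z : Fin N → (Fin 4 → ℤ))
    (hin : ∀ k, ∀ (y : Fin 4 → ℤ), y ∈ box 4 (ℓ + W) → z k + y ∈ box 4 R) (k : Fin N) : 2 * (ℓ + W) + 1 < n := by
  have h1 := (mem_box.1 (hin k (fun _ => ((ℓ + W : ℕ) : ℤ)) (mem_box.2 fun i => ⟨by omega, le_rfl⟩))) 0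
  have h2 := (mem_box.1 (hin k (fun _ => -((ℓ + W : ℕ) : ℤ)) (mem_box.2 fun i => ⟨le_rfl, by omega⟩))) 0
  simp only [Pi.add_apply] at h1 h2
  omega

end Summit.QuantumFields.QCD.Cruxes.TipPricing.ModularTemplate

end
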